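import Summits.BirchSwinnertonDyer.Rank1Residual.Additive.BranchPAdicGrossZagierIff
import Summits.BirchSwinnertonDyer.Rank1Residual.Additive.CongruentPartnerMainConjectureGord
import Summits.BirchSwinnertonDyer.Rank1Residual.Additive.BranchPAdicGrossZagierConverseNoRider
import HarnessLib

/-!
# T-E3g (ii)(iii) (route planner 2, ROUTE-2 §II.12 "rank-one reach of Route G"): on the index-`n₀`
# rows of X4♯(G-ord) ∩ `I₀*` ∩ {`ρ̄_{E,p}` onto} in analytic rank one, the partner-free Route-G inputs
# [index-`b` UNIT coefficient `BranchUnitCoeffAt W p b` + budget `BudgetLeLambdaAt p W b`] (seat p10's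
# K-OUT, FILE 2) and ONE one-sided analytic bit [`[T¹](ϖ·B) ≠ 0`, `BranchCoeffOneNeZeroAt W p`,
# additive-p2] DISCHARGE both non-published hypotheses of this seat's IMC-version iffs — the typed LOWER
# `hdiv` and the Schneider rider `hSall` — leaving `BSD(E,p) ⟺ ∀ (B)-data, the typed branch p-adic
# Gross–Zagier` over Kato + Delbourgo + two finite `p`-adic certificates + the typed budget, and the EXACT identity
# `ord_p #Ш(E) + ord_p Reg_p(E,Dh) + ord_p ∏c_ℓ + ord_p ℓ = v₁ + 1 + 2·ord_p #E(ℚ)_tors`, `v₁ = v_p([T¹](ϖ·B))`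
# (cell `b2b-bsdres`, team n1011, seat p01 GEN 2; rows T-O7c × T-E3d; composes p255614 (this seat),
# p255527 (p10 K-OUT) and additive-p2's `GordRankOneKatoUpperBound` BY NAME — three glue theorems and
# one cell-agnostic identity, no new currency)

HONEST FRAMING (cell `b2b-bsdres`, run/shared/lean/b2b/bsd-rank1-residual/, verbatim in every
file): prove what is provable now; shrink each hard class to its core with data; no claim beyond
stated classes. Research routes; census output = EVIDENCE / conjecture items, never a Literature
fact; RESIDUAL-MAP marks change only by signed lines. §I O7 stays OPEN; X4♯(G-ord) stays
CONSTRUCTION-SHAPED; nothing is booked; no label changes. COVERAGE (stated first, referee 1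
proviso): X4♯(G-ord) ∩ `I₀*` — `E = V ⊗ χ_{p*}`, `V` good ordinary, defect `e_E(p) = 2`, `E[p]`
irreducible (X4) with `ρ̄_{E,p}` SURJECTIVE — of analytic rank `1`, NON-ANOMALOUS (`hna`); even branch
`p ≡ 1 (mod 4)` and odd branch `p ≡ 3 (mod 4)` with `p ≥ 7` over A175 (`hDel`, no CM DISCHARGED from
surj(p) at `p ≥ 5` via the twist, Serre), odd branch `p = 3` over p16's `mainTheorem_three` (`hDel3`;
`hcm` stays a binder at `3`). Per-pair TYPED certificate inputs (finite `p`-adic computations, nothing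
asserted): `BranchUnitCoeffAt W p b` (‖[T^b](ϖ·B)‖ = 1 for every admissible datum), `BudgetLeLambdaAt p W b`
(r2 / p10: `b ≤ λ(X)` whenever `X` torsion with `μ = 0`; discharged per pair from MW or EPW budgets —
NOT here), `BranchCoeffOneNeZeroAt W p` (`[T¹](ϖ·B) ≠ 0`). PUBLISHED binders: Kato 17.4 (3) half-eigen
reading `hK`, `hmod`, `hmodD`, `hGZK`, Delbourgo (A)+(B) `hDel`/`hDel3`. NO definition, NO Literature
fact, NO `_holds`; theorems only. OUTPUT IS NOT `BSD_p`: the typed `p`-adic Gross–Zagier (O7-ord) stays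
the residue — exactly route planner 2's reading (ROUTE-2 §II.12 (2)).

## What

* §1 (cell-agnostic, T-E3g (ii)) `schneider_and_padicVal_identity_rankOne_of_charIdeal_eq_span_of_iota_eq`:
  `rank = 1`, a (B)-datum `Dh`, a torsion cyclotomic dual datum whose characteristic ideal is GENERATED
  by `g` with `ι g = C(u·ϖ)·B` (the main conjecture on the branch, e.g. K-OUT's output) and
  `[T¹](ϖ·B) ≠ 0` ⟹ Schneider (`Reg_p(E,Dh) ≠ 0`), `Ш[p^∞]` finite, and the EXACT identity
  `ord_p #Ш[p^∞] + ord_p Reg_p + ord_p ∏c + ord_p ℓ = v_p([T¹](ϖ·B)) + 1 + 2·ord_p #tors` (`ℓ ∣ p²`, `= 1`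
  off the anomalous rows) — additive-p2's `schneider_and_padicVal_le_rankOne_of_iota_eq` gives `≤` from
  `g ∈ char`; equality is clause 3 of (B) applied to the generator `g` itself.
* §2 X4♯(G-ord) class forms, EVERY odd `p`: `ClassX4Gord.not_hasCM_of_surj_of_five_le` (Serre, via the
  twist); `ClassX4Gord.forall_schneider_of_katoHalf_of_coeffOneNeZero` — `∀ Dh, LeadingTermClauses →
  Schneider` from Kato + `[T¹](ϖ·B) ≠ 0`, tower from surj(p) by `ClassX4Gord.towerSurj_of_surj` (so NO
  `5 ≤ p`, unlike additive-p2's `schneider_of_katoHalf_of_ne_zero`); `ClassX4Gord.schneider_and_padicVal_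
  identity_rankOne_of_katoHalf_of_coeffCert_of_budget` — the `v₁`-identity per admissible datum.
* §3 CAPSTONES (T-E3g (iii)): `ClassX4Gord.bsdp_iff_forall_branchPAdicGrossZagier[Odd]At_of_katoHalf_of_
  coeffCert_of_budget` (even; odd `p ≥ 7`) and `ClassX4Gord.bsdp_three_iff_…_of_coeffCert_of_budget`:
  `BSDp W p ↔ ∀ Dh, LeadingTermClauses W p Dh → BranchPAdicGrossZagier[Odd]At W p Dh` with `hdiv :=`
  K-OUT (`ClassX4Gord.chiBranchLowerDivisibility[Odd]At_of_katoHalf_of_coeffCert_of_budget`) and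
  `hSall :=` §2.

References: [Delbourgo2002] Thm. (A), (B) (p. 40), Hypothesis p. 39; [Kato2004Asterisque] Thm. 17.4
(3); [Wuthrich2014] §3, Cor. 19, Lemma 20; [Serre1972] §4.5; [EmertonPollackWeston2006] Cor. 3.2.5,
Thm. 3.1.1 (shape of the budget; nothing asserted); [MazurTateTeitelbaum1986Invent] §I.13–I.14;
[Miller2011LMS] Def. 1.1; [Washington1997] §7.1, §13.2.
-/

noncomputable section

open scoped Classical MatrixGroups ModularForm NumberField

open CongruenceSubgroup WeierstrassCurve NumberField Literature.NumberTheory.EllipticCurves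
  Literature.NumberTheory.EllipticCurves.ModularForms
  Literature.NumberTheory.EllipticCurves.Rank1Residual
  Literature.NumberTheory.EllipticCurves.Rank1Residual.Typed
  Literature.NumberTheory.EllipticCurves.Delbourgo2002
  Literature.NumberTheory.GaloisRepresentations
  IsDedekindDomain

namespace Summit.BirchSwinnertonDyer.Rank1Residual.Additive

variable {W : WeierstrassCurve ℚ} [W.IsElliptic] [W.IsGloballyMinimal] {p : ℕ} [hp : Fact p.Prime]

/-! ### §1 Cell-agnostic: the main conjecture on the branch + `[T¹](ϖ·B) ≠ 0` ⟹ Schneider + the exact identity -/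

omit [W.IsGloballyMinimal] in
/-- **T-E3g (ii), the rank-one RIDER LEMMA with the exact identity (cell-agnostic).** Let `p ≠ 2`,
`rank_ℤ E(ℚ) = 1`, `Dh` a height datum with Delbourgo's (B)-clauses, `D` a cyclotomic dual datum
with `X` torsion whose characteristic ideal is GENERATED by `g`, `ι g = C(u·ϖ)·B` (`u ∈ ℤ_p^×`), and
`[T¹](ϖ·B) ≠ 0`. Then `Reg_p(E,Dh) ≠ 0` (Schneider), `Ш(E/ℚ)[p^∞]` is finite, and
`ord_p #Ш[p^∞] + ord_p Reg_p(E,Dh) + ord_p ∏c_ℓ + ord_p ℓ = v_p([T¹](ϖ·B)) + 1 + 2·ord_p #E(ℚ)_tors`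
for some `ℓ ∣ p²` with `ℓ = 1` off the anomalous rows (clause 2: `ord g = 1 = rank`; clause 3 at the
generator `g`; `log_p γ = p·unit`). [cite: Delbourgo2002, Theorem (B) (p. 40)]
[cite: Washington1997, §7.1] [cite: Iwasawa1972PadicL, §4.4 (log_p(1+p) = p·unit)] -/
theorem schneider_and_padicVal_identity_rankOne_of_charIdeal_eq_span_of_iota_eq (hp2 : p ≠ 2)
    (hr1 : W.mordellWeilRank = 1) {Dh : PAdicHeightData W p} (hB : LeadingTermClauses W p Dh)
    {κ : ZpExtension ℚ p} {γ : Field.absoluteGaloisGroup ℚ}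
    (hκ : κ.IsCyclotomic) (hγ : κ.IsTopGenerator γ) (hγ' : IsCyclotomicVariable p γ)
    (D : W.SelmerDualData κ γ) [Module.Finite (IwasawaAlgebra p) D.X] (hXt : D.IsTorsion)
    {g : IwasawaAlgebra p} (hchar : D.charIdeal = Ideal.span {g})
    {u : ℤ_[p]ˣ} {ϖ : ℚ} {B : PowerSeries ℚ_[p]}
    (hι : iwasawaToPowerSeries p g = PowerSeries.C (((u : ℤ_[p]) : ℚ_[p]) * (ϖ : ℚ_[p])) * B)
    (hne : PowerSeries.coeff 1 (PowerSeries.C (ϖ : ℚ_[p]) * B) ≠ 0) :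
    SchneiderConjecture Dh ∧ Finite (AddCommGroup.primaryComponent W.sha p) ∧
      ∃ ℓ : ℕ, ℓ ∣ p ^ 2 ∧ (ReductionNonAnomalous W p → ℓ = 1) ∧
        (padicValNat p (Nat.card (AddCommGroup.primaryComponent W.sha p)) : ℤ) +
            (padicRegulator Dh).valuation + padicValNat p W.tamagawaProduct + padicValNat p ℓ =
          (PowerSeries.coeff 1 (PowerSeries.C (ϖ : ℚ_[p]) * B)).valuation + 1 +
            2 * padicValNat p W.torsionOrder := by
  have hpP : p.Prime := hp.out
  obtain ⟨hS, hfin, -⟩ := schneider_and_padicVal_le_rankOne_of_iota_eq hp2 hr1 hB hκ hγ hγ' D hXt hchar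
    (by rw [hchar]; exact Ideal.mem_span_singleton_self g) hι hne
  obtain ⟨uB, ℓ, hℓp, hℓ1, heq⟩ := (hB κ γ hκ hγ hγ' D hXt g hchar).2.2 hS hfin
  refine ⟨hS, hfin, ℓ, hℓp, hℓ1, ?_⟩
  rw [hr1, pow_one] at heq
  -- the pieces and their valuations
  have hg1 : ((PowerSeries.coeff 1 g : ℤ_[p]) : ℚ_[p]) =
      ((u : ℤ_[p]) : ℚ_[p]) * PowerSeries.coeff 1 (PowerSeries.C (ϖ : ℚ_[p]) * B) :=
    coe_coeff_one_eq_of_iota_eq hι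
  have hu0 : ((u : ℤ_[p]) : ℚ_[p]) ≠ 0 := coe_units_ne_zero p u
  have hg10 : ((PowerSeries.coeff 1 g : ℤ_[p]) : ℚ_[p]) ≠ 0 := by rw [hg1]; exact mul_ne_zero hu0 hne
  have hg1v : (((PowerSeries.coeff 1 g : ℤ_[p]) : ℚ_[p])).valuation =
      (PowerSeries.coeff 1 (PowerSeries.C (ϖ : ℚ_[p]) * B)).valuation := by
    rw [hg1, Padic.valuation_mul hu0 hne, valuation_coe_units_eq_zero, zero_add]
  obtain ⟨w, hw⟩ := exists_unit_padicLog_cyclotomicGenerator (p := p) hp2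
  have hpQ : (p : ℚ_[p]) ≠ 0 := by exact_mod_cast hpP.ne_zero
  have hlog0 : padicLog p (cyclotomicGenerator p : ℚ_[p]) ≠ 0 := by
    rw [hw]; exact mul_ne_zero hpQ (coe_units_ne_zero p w)
  have hlogv : (padicLog p (cyclotomicGenerator p : ℚ_[p])).valuation = 1 := by
    rw [hw, Padic.valuation_mul hpQ (coe_units_ne_zero p w), Padic.valuation_p,
      valuation_coe_units_eq_zero, add_zero]
  have hT0 : W.torsionOrder ≠ 0 := (W.torsionOrder_pos_holds).ne'
  have hTQ : (W.torsionOrder : ℚ_[p]) ≠ 0 := by exact_mod_cast hT0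
  have huB0 : ((uB : ℤ_[p]) : ℚ_[p]) ≠ 0 := coe_units_ne_zero p uB
  have hℓ0 : ℓ ≠ 0 := by
    rintro rfl
    exact hpP.ne_zero (pow_eq_zero_iff (n := 2) (by norm_num) |>.mp (zero_dvd_iff.mp hℓp))
  have hℓQ : (ℓ : ℚ_[p]) ≠ 0 := by exact_mod_cast hℓ0
  haveI : Finite (AddCommGroup.primaryComponent W.sha p) := hfin
  have hShp0 : (Nat.card (AddCommGroup.primaryComponent W.sha p) : ℚ_[p]) ≠ 0 := by
    exact_mod_cast Nat.card_pos.ne'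
  have hRg0 : padicRegulator Dh ≠ 0 := hS
  have hCc0 : (W.tamagawaProduct : ℚ_[p]) ≠ 0 := by
    exact_mod_cast (W.tamagawaProduct_pos_holds : 0 < W.tamagawaProduct).ne'
  -- valuations of both sides of clause 3 at the generator `g`
  have hL : (((PowerSeries.coeff 1 g : ℤ_[p]) : ℚ_[p]) *
        padicLog p (cyclotomicGenerator p) * (W.torsionOrder : ℚ_[p]) ^ 2).valuation =
      (PowerSeries.coeff 1 (PowerSeries.C (ϖ : ℚ_[p]) * B)).valuation + 1 +
        2 * (padicValNat p W.torsionOrder : ℤ) := by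
    rw [Padic.valuation_mul (mul_ne_zero hg10 hlog0) (pow_ne_zero 2 hTQ), Padic.valuation_mul hg10 hlog0,
      Padic.valuation_pow, hg1v, hlogv, Padic.valuation_natCast]
    push_cast
    ring
  have hR : (((uB : ℤ_[p]) : ℚ_[p]) * (ℓ : ℚ_[p]) *
        ((Nat.card (AddCommGroup.primaryComponent W.sha p) : ℚ_[p]) * padicRegulator Dh *
          (W.tamagawaProduct : ℚ_[p]))).valuation =
      (padicValNat p ℓ : ℤ) +
        ((padicValNat p (Nat.card (AddCommGroup.primaryComponent W.sha p)) : ℤ) +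
          (padicRegulator Dh).valuation + padicValNat p W.tamagawaProduct) := by
    rw [Padic.valuation_mul (mul_ne_zero huB0 hℓQ) (mul_ne_zero (mul_ne_zero hShp0 hRg0) hCc0),
      Padic.valuation_mul huB0 hℓQ, valuation_coe_units_eq_zero, zero_add, Padic.valuation_natCast,
      Padic.valuation_mul (mul_ne_zero hShp0 hRg0) hCc0, Padic.valuation_mul hShp0 hRg0,
      Padic.valuation_natCast, Padic.valuation_natCast]
  have hval := congrArg Padic.valuation heq
  rw [hL, hR] at hval
  linarith

/-! ### §2 X4♯(G-ord) ∩ `I₀*` ∩ {`ρ̄_{E,p}` onto}: no CM; Schneider from `[T¹](ϖ·B) ≠ 0`; the `v₁`-identity -/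

/-- **No CM on X4♯(G-ord) ∩ {`ρ̄_{E,p}` onto}, `p ≥ 5`** (Serre: a good ORDINARY prime `p ≥ 5` with
`ρ̄_{V,p}` onto forbids CM for the twist `V`; CM is twist-invariant). Discharges A175's `hcm` on these
rows. [cite: Serre1972, §4.5] -/
theorem ClassX4Gord.not_hasCM_of_surj_of_five_le (hX : ClassX4Gord W p) (he : semistabilityIndex W p = 2)
    (hp5 : 5 ≤ p) (hsurj : Surj W p) : ¬ W.HasCM := by
  obtain ⟨V, iV, iVm, C, hV, hC⟩ := hX.exists_goodOrd_pStar_twist_model W p he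
  have hsV : Surj V p := (surj_iff_of_model_twist V p (pStar_ne_zero p) ⟨C, hC⟩).mp hsurj
  exact fun hcm ↦ not_hasCM_of_hasSurjectiveModNGaloisRep_of_five_le V p hp5 hV.1 hV.2 hsV
    ((hasCM_iff_of_model_twist (pStar_ne_zero p) ⟨C, hC⟩).mp hcm)

/-- **Schneider for EVERY (B)-datum on X4♯(G-ord) ∩ `I₀*` ∩ {`ρ̄_{E,p}` onto}, `r_an = 1`, EVERY odd `p`
(`p = 3` included), from the one-sided analytic bit `[T¹](ϖ·B) ≠ 0`** (`BranchCoeffOneNeZeroAt W p`) and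
Kato's half: the twist datum is discharged (`exists_goodOrd_pStar_twist_model`, `hmodD`, the period
ratio of the parity), the tower from surj(p) ALONE (`ClassX4Gord.towerSurj_of_surj`, so NO `5 ≤ p` —
the `hp5`-free twin of additive-p2's `ClassX4Gord.schneider_of_katoHalf_of_ne_zero`), and additive-p2's
core `schneider_and_padicVal_le_rankOne_of_iota_eq`. This is the `hSall` input of this seat's iffs.
[cite: Kato2004Asterisque, Thm. 17.4 (3) (p. 273)] [cite: Delbourgo2002, Theorem (B) (p. 40)] -/
theorem ClassX4Gord.forall_schneider_of_katoHalf_of_coeffOneNeZero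
    (hK : Wuthrich2014.kato_halfEigenCharIdeal_dvd_cyclotomicPrime_of_surjective)
    (hmodD : nonempty_modularParametrizationData)
    (hGZK : rank_eq_analyticRank_of_analyticRank_le_one)
    (hX : ClassX4Gord W p) (he : semistabilityIndex W p = 2) (hsurj : Surj W p)
    (hr : W.analyticRank = 1) (hne : BranchCoeffOneNeZeroAt W p) :
    ∀ Dh : PAdicHeightData W p, LeadingTermClauses W p Dh → SchneiderConjecture Dh := by
  intro Dh hB
  have hp2 : p ≠ 2 := hX.addv.1
  obtain ⟨hmw, -⟩ := hGZK W (by rw [hr])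
  have hr1 : W.mordellWeilRank = 1 := by rw [hmw, hr]
  obtain ⟨V, iV, iVm, C, hV, hC⟩ := hX.exists_goodOrd_pStar_twist_model W p he
  haveI : NeZero (V.conductorNorm ℤ) := ⟨(V.conductorNorm_pos_holds).ne'⟩
  obtain ⟨Dm⟩ := hmodD V
  obtain ⟨ϖ, hϖ⟩ := exists_periodRatio_parity (p := p) V Dm
  have hj := padicValRat_j_nonneg_of_typeGOrd W p hX.typeGOrd
  have hord : IsOrdinaryAt V p :=
    isOrdinaryAt_of_goodOrd_or_mult_of_model_twist W V (pStar_ne_zero p) ⟨C, hC⟩ hj (Or.inl hV)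
  have htowerV : ∀ n : ℕ, V.HasSurjectiveModNGaloisRep (p ^ n : ℕ) := fun n ↦
    (GaloisImage.hasSurjectiveModNGaloisRep_pow_iff_of_model_twist V p (pStar_ne_zero p) ⟨C, hC⟩ n).mp
      (hX.towerSurj_of_surj he hsurj n)
  obtain ⟨κ, γ, hκ, hγ, hγ', D, fE, hchar⟩ := exists_cyclotomic_dualData_generator W p
  haveI : Module.Finite (IwasawaAlgebra p) D.X :=
    SelmerDualData.module_finite_of_isCyclotomic (W := W) (κ := κ) hκ D hγ
  obtain ⟨hXt, g, hg, u, hι⟩ := isTorsion_and_exists_iota_eq_branch_of_katoComponent W p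
    (Kato2004.charIdeal_dvd_padicLFunctionBranch_component_of_surjective_of_half hK) hj hp2 V ⟨C, hC⟩
    (Or.inl hord) htowerV hκ hγ hγ' Dm.isNewformOf D ϖ hϖ
  exact (schneider_and_padicVal_le_rankOne_of_iota_eq hp2 hr1 hB hκ hγ hγ' D hXt hchar hg hι
    (hne V C hC hord Dm.f Dm.isNewformOf ϖ hϖ)).1

/-- **T-E3g (ii) on the rows: the EXACT `v₁`-identity per admissible datum.** X4♯(G-ord) ∩ `I₀*` ∩
{`ρ̄_{E,p}` onto}, `r_an = 1`, EVERY odd `p`; Kato's half + the index-`b` unit coefficient + the budget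
(K-OUT: `char_Λ X = (g)`, `ι g = C(u·ϖ)·B`) + `[T¹](ϖ·B) ≠ 0` for THIS datum ⟹ for every (B)-datum `Dh`:
Schneider and `ord_p #Ш(E) + ord_p Reg_p(E,Dh) + ord_p ∏c_ℓ + ord_p ℓ = v_p([T¹](ϖ·B)) + 1 + 2·ord_p #E(ℚ)_tors`
(`Ш(E)` finite by GZK). On index-1 UNIT rows (`v₁ = 0`) this is additive-p2's
`…identity_rankOne_of_katoHalf_of_cert`. [cite: Delbourgo2002, Theorem (B) (p. 40)]
[cite: Kato2004Asterisque, Thm. 17.4 (3) (p. 273)] [cite: EmertonPollackWeston2006, Cor. 3.2.5 (shape of the budget)] -/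
theorem ClassX4Gord.schneider_and_padicVal_identity_rankOne_of_katoHalf_of_coeffCert_of_budget
    (hK : Wuthrich2014.kato_halfEigenCharIdeal_dvd_cyclotomicPrime_of_surjective)
    (hGZK : rank_eq_analyticRank_of_analyticRank_le_one)
    (hX : ClassX4Gord W p) (he : semistabilityIndex W p = 2) (hsurj : Surj W p)
    (hr : W.analyticRank = 1) {b : ℕ} (hcert : BranchUnitCoeffAt W p b) (hbud : BudgetLeLambdaAt p W b)
    (V : WeierstrassCurve ℚ) [V.IsElliptic] [V.IsGloballyMinimal] (C : VariableChange ℚ)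
    (hC : C • V.quadraticTwist ((-1 : ℚ) ^ (p / 2) * p) = W) (hV : GoodOrd V p)
    {N : ℕ} [NeZero N] {f : CuspForm (Gamma0 N) 2} (hf : IsNewformOf V f) (ϖ : ℚ)
    (hϖ : if Even (p / 2) then (ϖ : ℝ) * V.realPeriodRat = plusPeriod f
      else (ϖ : ℝ) * V.imaginaryPeriodRat = minusPeriod f)
    (hne : PowerSeries.coeff 1 (PowerSeries.C (ϖ : ℚ_[p]) *
      (if Even (p / 2) then padicLFunctionBranch f ((unitRoot V p : ℤ_[p]) : ℚ_[p]) (p / 2)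
        else padicLFunctionMinusBranch f ((unitRoot V p : ℤ_[p]) : ℚ_[p]) (p / 2))) ≠ 0)
    {Dh : PAdicHeightData W p} (hB : LeadingTermClauses W p Dh) :
    SchneiderConjecture Dh ∧
      ∃ ℓ : ℕ, ℓ ∣ p ^ 2 ∧ (ReductionNonAnomalous W p → ℓ = 1) ∧
        (padicValNat p W.shaOrder : ℤ) + (padicRegulator Dh).valuation +
            padicValNat p W.tamagawaProduct + padicValNat p ℓ =
          (PowerSeries.coeff 1 (PowerSeries.C (ϖ : ℚ_[p]) *
              (if Even (p / 2) then padicLFunctionBranch f ((unitRoot V p : ℤ_[p]) : ℚ_[p]) (p / 2)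
                else padicLFunctionMinusBranch f ((unitRoot V p : ℤ_[p]) : ℚ_[p]) (p / 2)))).valuation +
            1 + 2 * padicValNat p W.torsionOrder := by
  have hp2 : p ≠ 2 := hX.addv.1
  obtain ⟨hmw, hfinSha⟩ := hGZK W (by rw [hr])
  have hr1 : W.mordellWeilRank = 1 := by rw [hmw, hr]
  haveI : Finite W.sha := hfinSha
  obtain ⟨κ, γ, hκ, hγ, hγ', D, fE, -⟩ := exists_cyclotomic_dualData_generator W p
  haveI : Module.Finite (IwasawaAlgebra p) D.X :=
    SelmerDualData.module_finite_of_isCyclotomic (W := W) (κ := κ) hκ D hγ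
  obtain ⟨hXt, g, u, hchar, hι, -, -⟩ := hX.mainConjecture_of_katoHalf_of_coeffCert_of_budget hK he hsurj
    hcert hbud V C hC hV hκ hγ hγ' hf D ϖ hϖ
  obtain ⟨hS, -, ℓ, hℓp, hℓ1, hid⟩ :=
    schneider_and_padicVal_identity_rankOne_of_charIdeal_eq_span_of_iota_eq hp2 hr1 hB hκ hγ hγ' D hXt
      hchar hι hne
  refine ⟨hS, ℓ, hℓp, hℓ1, ?_⟩
  rw [padicValNat_card_addPrimaryComponent] at hid
  exact hid

/-! ### §3 CAPSTONES (T-E3g (iii)): the IMC-version iffs with `hdiv` and `hSall` DISCHARGED by certificates -/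

/-- **CAPSTONE, even branch.** X4♯(G-ord) ∩ `I₀*` ∩ {`ρ̄_{E,p}` onto}, `p ≡ 1 (mod 4)`, `r_an = 1`,
non-anomalous; GIVEN Kato's half, Delbourgo (A)+(B) (A175), modularity, `hmodD`, GZK, the index-`b`
unit coefficient `BranchUnitCoeffAt W p b` with the budget `BudgetLeLambdaAt p W b` (⟹ the typed LOWER,
K-OUT) and `[T¹](ϖ·B) ≠ 0` (⟹ Schneider ∀ (B)-data): **`BSD(E,p) ⟺ ∀ (B)-data, BranchPAdicGrossZagierAt`**.
No CM DISCHARGED (Serre). This seat's p255614 iff with both non-published hypotheses replaced by finite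
`p`-adic certificates. [cite: Delbourgo2002, Theorem (A), (B), Example (p. 40)]
[cite: Kato2004Asterisque, Thm. 17.4 (3) (p. 273)] [cite: Serre1972, §4.5] [cite: Miller2011LMS, Def. 1.1] -/
theorem ClassX4Gord.bsdp_iff_forall_branchPAdicGrossZagierAt_of_katoHalf_of_coeffCert_of_budget
    (hDel : Delbourgo2002.mainTheorem)
    (hK : Wuthrich2014.kato_halfEigenCharIdeal_dvd_cyclotomicPrime_of_surjective)
    (hmod : hasEntireLFunction_rat) (hmodD : nonempty_modularParametrizationData)
    (hGZK : rank_eq_analyticRank_of_analyticRank_le_one) (hX : ClassX4Gord W p)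
    (he : semistabilityIndex W p = 2) (hp4 : p % 4 = 1) (hna : ReductionNonAnomalous W p)
    (hsurj : Surj W p) (hr : W.analyticRank = 1)
    {b : ℕ} (hcert : BranchUnitCoeffAt W p b) (hbud : BudgetLeLambdaAt p W b)
    (hne : BranchCoeffOneNeZeroAt W p) :
    BSDp W p ↔ ∀ Dh : PAdicHeightData W p, LeadingTermClauses W p Dh → BranchPAdicGrossZagierAt W p Dh :=
  hX.bsdp_iff_forall_branchPAdicGrossZagierAt_of_chiBranchLower_of_katoHalf hDel hK hmod hmodD hGZK he hp4
    (hX.not_hasCM_of_surj_of_five_le he (by have := hp.out.two_le; omega) hsurj) hna hsurj hr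
    (hX.chiBranchLowerDivisibilityAt_of_katoHalf_of_coeffCert_of_budget hK he hsurj hcert hbud)
    (hX.forall_schneider_of_katoHalf_of_coeffOneNeZero hK hmodD hGZK he hsurj hr hne)

/-- **CAPSTONE, odd branch `p ≥ 7`.** X4♯(G-ord) ∩ `I₀*` ∩ {`ρ̄_{E,p}` onto}, `p ≡ 3 (mod 4)`, `p ≥ 5`,
`r_an = 1`, non-anomalous; same inputs on the odd branch: **`BSD(E,p) ⟺ ∀ (B)-data,
BranchPAdicGrossZagierOddAt`**. [cite: Delbourgo2002, Theorem (A), (B), Example (p. 40)]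
[cite: Kato2004Asterisque, Thm. 17.4 (3) (p. 273)] [cite: Serre1972, §4.5] [cite: Miller2011LMS, Def. 1.1] -/
theorem ClassX4Gord.bsdp_iff_forall_branchPAdicGrossZagierOddAt_of_katoHalf_of_coeffCert_of_budget
    (hDel : Delbourgo2002.mainTheorem)
    (hK : Wuthrich2014.kato_halfEigenCharIdeal_dvd_cyclotomicPrime_of_surjective)
    (hmod : hasEntireLFunction_rat) (hmodD : nonempty_modularParametrizationData)
    (hGZK : rank_eq_analyticRank_of_analyticRank_le_one) (hX : ClassX4Gord W p)
    (he : semistabilityIndex W p = 2) (hp4 : p % 4 = 3) (hp5 : 5 ≤ p) (hna : ReductionNonAnomalous W p)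
    (hsurj : Surj W p) (hr : W.analyticRank = 1)
    {b : ℕ} (hcert : BranchUnitCoeffAt W p b) (hbud : BudgetLeLambdaAt p W b)
    (hne : BranchCoeffOneNeZeroAt W p) :
    BSDp W p ↔
      ∀ Dh : PAdicHeightData W p, LeadingTermClauses W p Dh → BranchPAdicGrossZagierOddAt W p Dh :=
  hX.bsdp_iff_forall_branchPAdicGrossZagierOddAt_of_chiBranchLowerOdd_of_katoHalf hDel hK hmod hmodD hGZK
    he hp4 hp5 (hX.not_hasCM_of_surj_of_five_le he hp5 hsurj) hna hsurj hr
    (hX.chiBranchLowerDivisibilityOddAt_of_katoHalf_of_coeffCert_of_budget hK he hsurj hcert hbud)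
    (hX.forall_schneider_of_katoHalf_of_coeffOneNeZero hK hmodD hGZK he hsurj hr hne)

/-- **CAPSTONE, odd branch `p = 3`.** X4♯(G-ord) ∩ `I₀*` ∩ {`ρ̄_{E,3}` onto}, `r_an = 1`, non-CM
(`hcm` stays a binder at `3`), non-anomalous, over p16's `Delbourgo2002.mainTheorem_three`; the index-`b`
unit coefficient + budget at `3` (K-OUT) and `[T¹](ϖ·B⁻) ≠ 0`: **`BSD(E,3) ⟺ ∀ (B)-data,
BranchPAdicGrossZagierOddAt W 3`** (`e_E(3) = 2` automatic for type (G) at `3`).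
[cite: Delbourgo2002, Theorem (A), (B) (p. 40)] [cite: Kato2004Asterisque, Thm. 17.4 (3) (p. 273)]
[cite: Miller2011LMS, Def. 1.1] -/
theorem ClassX4Gord.bsdp_three_iff_forall_branchPAdicGrossZagierOddAt_of_katoHalf_of_coeffCert_of_budget
    (hDel3 : Delbourgo2002.mainTheorem_three)
    (hK : Wuthrich2014.kato_halfEigenCharIdeal_dvd_cyclotomicPrime_of_surjective)
    (hmod : hasEntireLFunction_rat) (hmodD : nonempty_modularParametrizationData)
    (hGZK : rank_eq_analyticRank_of_analyticRank_le_one) (hX : ClassX4Gord W 3)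
    (hcm : ¬ W.HasCM) (hna : ReductionNonAnomalous W 3) (hsurj : Surj W 3) (hr : W.analyticRank = 1)
    {b : ℕ} (hcert : BranchUnitCoeffAt W 3 b) (hbud : BudgetLeLambdaAt 3 W b)
    (hne : BranchCoeffOneNeZeroAt W 3) :
    BSDp W 3 ↔
      ∀ Dh : PAdicHeightData W 3, LeadingTermClauses W 3 Dh → BranchPAdicGrossZagierOddAt W 3 Dh :=
  have he : semistabilityIndex W 3 = 2 := semistabilityIndex_eq_two_of_typeG_three W hX.typeGOrd.typeG hX.addv.2
  hX.bsdp_three_iff_forall_branchPAdicGrossZagierOddAt_of_chiBranchLowerOdd_of_katoHalf hDel3 hK hmod hmodD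
    hGZK hcm hna hsurj hr
    (hX.chiBranchLowerDivisibilityOddAt_of_katoHalf_of_coeffCert_of_budget hK he hsurj hcert hbud)
    (hX.forall_schneider_of_katoHalf_of_coeffOneNeZero hK hmodD hGZK he hsurj hr hne)

/-! ### §4 (append) The `⇒` direction is BIT-FREE, RIDER-FREE and DELBOURGO-FREE: `BSD(E,p)` ∧ K-OUT ⟹ typed `p`-adic GZ ∀ (B)-data -/

/-- **`⇒` direction of the capstones with NO one-sided bit, NO rider, NO Delbourgo fact, NO `hcm`,
EVERY odd `p` (the even-branch predicate carries `p ≡ 1 (mod 4)` inside; vacuous otherwise).**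
X4♯(G-ord) ∩ `I₀*` ∩ {`ρ̄_{E,p}` onto}, `e_E(p) = 2`, `r_an = 1`, non-anomalous; Kato's half + the index-`b`
unit coefficient + the budget (K-OUT ⟹ the typed LOWER) and `BSD(E,p)` ⟹ for EVERY height datum with
Delbourgo's (B)-clauses, `BranchPAdicGrossZagierAt W p Dh`. The one-sided bit `[T¹](ϖ·B) ≠ 0` and
Delbourgo's (A)+(B) existence statement are needed ONLY for the `⇐` direction (§3); this is the
rider-free converse `ClassX4Gord.branchPAdicGrossZagierAt_of_bsdp_of_chiBranchLower_of_katoHalf_noRider`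
(p257845) with `hdiv :=` K-OUT. [cite: Kato2004Asterisque, Thm. 17.4 (3) (p. 273)]
[cite: Delbourgo2002, Theorem (B) (p. 40) (shape of the clauses; nothing of (A)+(B) is used)]
[cite: Miller2011LMS, Def. 1.1] -/
theorem ClassX4Gord.forall_branchPAdicGrossZagierAt_of_bsdp_of_katoHalf_of_coeffCert_of_budget
    (hK : Wuthrich2014.kato_halfEigenCharIdeal_dvd_cyclotomicPrime_of_surjective)
    (hmod : hasEntireLFunction_rat) (hX : ClassX4Gord W p) (he : semistabilityIndex W p = 2)
    (hsurj : Surj W p) (hr : W.analyticRank = 1) (hna : ReductionNonAnomalous W p) (hbsd : BSDp W p)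
    {b : ℕ} (hcert : BranchUnitCoeffAt W p b) (hbud : BudgetLeLambdaAt p W b) :
    ∀ Dh : PAdicHeightData W p, LeadingTermClauses W p Dh → BranchPAdicGrossZagierAt W p Dh :=
  fun _ hB ↦ hX.branchPAdicGrossZagierAt_of_bsdp_of_chiBranchLower_of_katoHalf_noRider hK hmod hsurj hr
    hna hbsd (hX.chiBranchLowerDivisibilityAt_of_katoHalf_of_coeffCert_of_budget hK he hsurj hcert hbud) hB

/-- **Odd-branch twin, EVERY `p ≡ 3 (mod 4)` INCLUDING `p = 3` (no `5 ≤ p`, no `mainTheorem_three`, no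
`hcm`): `BSD(E,p)` ∧ Kato's half ∧ index-`b` unit coefficient ∧ budget ⟹ for EVERY (B)-datum,
`BranchPAdicGrossZagierOddAt W p Dh`.** [cite: Kato2004Asterisque, Thm. 17.4 (3) (p. 273)]
[cite: Delbourgo2002, Theorem (B) (p. 40) (shape of the clauses)] [cite: Miller2011LMS, Def. 1.1] -/
theorem ClassX4Gord.forall_branchPAdicGrossZagierOddAt_of_bsdp_of_katoHalf_of_coeffCert_of_budget
    (hK : Wuthrich2014.kato_halfEigenCharIdeal_dvd_cyclotomicPrime_of_surjective)
    (hmod : hasEntireLFunction_rat) (hX : ClassX4Gord W p) (he : semistabilityIndex W p = 2)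
    (hsurj : Surj W p) (hr : W.analyticRank = 1) (hna : ReductionNonAnomalous W p) (hbsd : BSDp W p)
    {b : ℕ} (hcert : BranchUnitCoeffAt W p b) (hbud : BudgetLeLambdaAt p W b) :
    ∀ Dh : PAdicHeightData W p, LeadingTermClauses W p Dh → BranchPAdicGrossZagierOddAt W p Dh :=
  fun _ hB ↦ hX.branchPAdicGrossZagierOddAt_of_bsdp_of_chiBranchLowerOdd_of_katoHalf_noRider hK hmod hsurj
    hr hna hbsd (hX.chiBranchLowerDivisibilityOddAt_of_katoHalf_of_coeffCert_of_budget hK he hsurj hcert hbud)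
    hB

end Summit.BirchSwinnertonDyer.Rank1Residual.Additive

end
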